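import Mathlib
import Summits.Ventures.PercRepro2.Defs
import Summits.Ventures.PercRepro2.Graph
import Summits.Ventures.PercRepro2.Induced
import Summits.Ventures.PercRepro2.VdBKahn
import Summits.Ventures.PercRepro2.ReimerVdBK
import Summits.Ventures.PercRepro2.ReimerVdBKRegions
import Summits.Ventures.PercRepro2.ReimerVdBKZClosed
import Summits.Ventures.PercRepro2.ReimerVdBKZReduction
import Summits.Ventures.PercRepro2.ReimerVdBKZSplit
import Summits.Ventures.PercRepro2.ReimerVdBKZRecursion
import Summits.Ventures.PercRepro2.ReimerVdBKTypeWeight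
import Summits.Ventures.PercRepro2.ReimerVdBKPairType
import Summits.Ventures.PercRepro2.ReimerVdBKCoreDown
import Summits.Ventures.PercRepro2.ReimerVdBKCoreD
import Summits.Ventures.PercRepro2.ReimerVdBKDegTwoGraph
import Summits.Ventures.PercRepro2.ReimerVdBKDegTwoFlip
import Summits.Ventures.PercRepro2.ReimerVdBKDegTwoExpansion

/-!
# The degree-2 expansion, IV: the rule with further core-avoided vertices (the calculus form)
(blind cell PercRepro2, mine-c g47; `conjectures/MINE-C.md` §56.7)

The expansion of part III with a set `N` of further core-avoided vertices (the `F₀`-vertices of the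
type-weight calculus, `MINE-C.md` §55.3): `4 · coreCount A X B Y (insert v N) = 2 · coreCount⁺ A X B Y N +
coreGensymCount° A X B Y N u₁ u₂` (`four_mul_coreCount_insert`), and THEOREM `coreDown_insert_of_genSymN`:
(CORE↓) at `N` on `G⁺` and the `N`-weighted GENSYM`(u₁, u₂)` on `G°` give (CORE↓) at `insert v N` on `G` —
the DEGREE-2 RULE of the calculus (with `N = ∅` it is `coreDown_of_genSym`).
-/

namespace Summit.Ventures.PercRepro2
namespace ReimerVdBK
open Classical

variable {V : Type*} {E : Type*} [Fintype E] [DecidableEq E] [Fintype V] [DecidableEq V]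
variable (ends : E → Sym2 V) (s : V)

omit [Fintype E] [DecidableEq E] [Fintype V] [DecidableEq V] in
/-- The core avoids every vertex of `N`. -/
def CoreAvoid (N : Finset V) (ω : Config E) : Prop :=
  ∀ w ∈ N, ¬ (Conn ends ω s w ∧ Conn ends (compl ω) s w)

section Defs
variable (A X B Y N : Finset V)

/-- The GENSYM count restricted to the colourings whose core avoids `N`. -/
noncomputable def coreGensymCount (a b : V) : ℕ :=
  ∑ ω : Config E, if ω ∈ twoWorld ends s A X B Y ∧ CoreAvoid ends s N ω then pairW ends s ω a b else 0

/-- **GENSYM`(a, b)` restricted to the core-avoidance of `N`** (left ≤ right). -/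
def GenSymN (a b : V) : Prop :=
  coreGensymCount ends s A X B Y N a b ≤ coreGensymCount ends s (A ∪ B) ∅ ∅ (X ∪ Y) N a b

/-- The core-restricted count at `N`, as a sum. -/
lemma coreCount_eq_sum_coreAvoid :
    coreCount ends s A X B Y N = ∑ ω : Config E,
      (if ω ∈ twoWorld ends s A X B Y ∧ CoreAvoid ends s N ω then 1 else 0) := by
  unfold coreCount
  rw [pcount_coreW_eq_count]
  unfold count
  refine Finset.sum_congr rfl fun ω _ => ?_
  by_cases h : ω ∈ twoWorld ends s A X B Y ∧ CoreAvoid ends s N ω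
  · rw [if_pos h, if_pos (show ω ∈ twoWorld ends s A X B Y ∩
      {ω | ∀ v ∈ N, ¬ (Conn ends ω s v ∧ Conn ends (compl ω) s v)} from ⟨h.1, h.2⟩)]
  · rw [if_neg h, if_neg (fun h' => h ⟨h'.1, h'.2⟩)]

/-- The core-restricted count at `insert v N`, as a sum. -/
lemma coreCount_insert_eq_sum (v : V) :
    coreCount ends s A X B Y (insert v N) = ∑ ω : Config E,
      (if ω ∈ twoWorld ends s A X B Y ∧ CoreAvoid ends s N ω ∧
        ¬ (Conn ends ω s v ∧ Conn ends (compl ω) s v) then 1 else 0) := by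
  unfold coreCount
  rw [pcount_coreW_eq_count]
  unfold count
  refine Finset.sum_congr rfl fun ω _ => ?_
  simp only [Set.mem_inter_iff, Set.mem_setOf_eq, Finset.mem_insert, forall_eq_or_imp, CoreAvoid]
  congr 1
  apply propext
  tauto

end Defs

section Expansion
variable {v u₁ u₂ : V} {e₁ e₂ : E} (A X B Y N : Finset V)

omit [Fintype E] [DecidableEq E] [Fintype V] [DecidableEq V] in
/-- Core avoidance transfers along connection equivalences at the vertices of `N`. -/
lemma coreAvoid_iff_of_conn_iff {ends' : E → Sym2 V} {ω : Config E}
    (h1 : ∀ w ∈ N, (Conn ends ω s w ↔ Conn ends' ω s w))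
    (h2 : ∀ w ∈ N, (Conn ends (compl ω) s w ↔ Conn ends' (compl ω) s w)) :
    CoreAvoid ends s N ω ↔ CoreAvoid ends' s N ω := by
  unfold CoreAvoid
  constructor
  · intro h w hw hc
    exact h w hw ⟨(h1 w hw).2 hc.1, (h2 w hw).2 hc.2⟩
  · intro h w hw hc
    exact h w hw ⟨(h1 w hw).1 hc.1, (h2 w hw).1 hc.2⟩

omit [Fintype E] [DecidableEq E] [Fintype V] [DecidableEq V] in
/-- With the two star edges of the same colour, `v` is not in the core. -/
lemma not_core_of_same (hd : Deg2 ends v u₁ u₂ e₁ e₂) (hsv : s ≠ v) {ω : Config E}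
    (hsame : ω e₁ = ω e₂) : ¬ (Conn ends ω s v ∧ Conn ends (compl ω) s v) := by
  rintro ⟨hv1, hv2⟩
  cases h : ω e₁ with
  | false => exact not_conn_of_star_closed ends s hd hsv h (hsame ▸ h) hv1
  | true =>
    have c1 : compl ω e₁ = false := by simp [compl_apply, h]
    have c2 : compl ω e₂ = false := by simp [compl_apply, ← hsame, h]
    exact not_conn_of_star_closed ends s hd hsv c1 c2 hv2

omit [Fintype E] [Fintype V] [DecidableEq V] in
/-- Core avoidance ignores the colour of a loop. -/
lemma coreAvoid_update_of_loop {ends' : E → Sym2 V} {e : E} (hloop : (ends' e).IsDiag)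
    (ω : Config E) (b : Bool) :
    CoreAvoid ends' s N (Function.update ω e b) ↔ CoreAvoid ends' s N ω := by
  unfold CoreAvoid
  simp only [compl_update_flip, conn_update_of_loop hloop]

/-- Same colour on the star, with `N`. -/
lemma term_sameN (hd : Deg2 ends v u₁ u₂ e₁ e₂) (hsv : s ≠ v) (hv : v ∉ A ∪ X ∪ B ∪ Y) (hvN : v ∉ N)
    {ω : Config E} (hsame : ω e₁ = ω e₂) :
    (if ω ∈ twoWorld ends s A X B Y ∧ CoreAvoid ends s N ω ∧ ¬ (Conn ends ω s v ∧ Conn ends (compl ω) s v) then (1 : ℕ) else 0) = (if ω ∈ twoWorld (endsPlus ends v u₁ u₂ e₁ e₂) s A X B Y ∧ CoreAvoid (endsPlus ends v u₁ u₂ e₁ e₂) s N ω then (1 : ℕ) else 0) := by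
  have hsame' : compl ω e₁ = compl ω e₂ := by simp [compl_apply, hsame]
  have hw : ∀ w ∈ A ∪ X ∪ B ∪ Y, w ≠ v := fun w hw hwv => hv (hwv ▸ hw)
  have hwN : ∀ w ∈ N, w ≠ v := fun w hw hwv => hvN (hwv ▸ hw)
  have htw : ω ∈ twoWorld ends s A X B Y ↔ ω ∈ twoWorld (endsPlus ends v u₁ u₂ e₁ e₂) s A X B Y :=
    mem_twoWorld_iff_of_conn_iff ends s A X B Y
      (fun w hw' => conn_iff_endsPlus ends s hd hsv hsame (hw w hw'))
      (fun w hw' => conn_iff_endsPlus ends s hd hsv hsame' (hw w hw'))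
  have hca : CoreAvoid ends s N ω ↔ CoreAvoid (endsPlus ends v u₁ u₂ e₁ e₂) s N ω :=
    coreAvoid_iff_of_conn_iff ends s N (fun w hw' => conn_iff_endsPlus ends s hd hsv hsame (hwN w hw'))
      (fun w hw' => conn_iff_endsPlus ends s hd hsv hsame' (hwN w hw'))
  have hcore := not_core_of_same ends s hd hsv hsame
  by_cases h : ω ∈ twoWorld ends s A X B Y ∧ CoreAvoid ends s N ω
  · rw [if_pos (show ω ∈ twoWorld ends s A X B Y ∧ CoreAvoid ends s N ω ∧
        ¬ (Conn ends ω s v ∧ Conn ends (compl ω) s v) from ⟨h.1, h.2, hcore⟩),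
      if_pos (show ω ∈ twoWorld (endsPlus ends v u₁ u₂ e₁ e₂) s A X B Y ∧ CoreAvoid (endsPlus ends v u₁ u₂ e₁ e₂) s N ω from ⟨htw.1 h.1, hca.1 h.2⟩)]
  · rw [if_neg (show ¬ (ω ∈ twoWorld ends s A X B Y ∧ CoreAvoid ends s N ω ∧
        ¬ (Conn ends ω s v ∧ Conn ends (compl ω) s v)) from fun h' => h ⟨h'.1, h'.2.1⟩),
      if_neg (show ¬ (ω ∈ twoWorld (endsPlus ends v u₁ u₂ e₁ e₂) s A X B Y ∧ CoreAvoid (endsPlus ends v u₁ u₂ e₁ e₂) s N ω) from fun h' => h ⟨htw.2 h'.1, hca.2 h'.2⟩)]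

/-- `e₁` open, `e₂` closed, with `N`. -/
lemma term_TFN (hd : Deg2 ends v u₁ u₂ e₁ e₂) (hsv : s ≠ v) (hv : v ∉ A ∪ X ∪ B ∪ Y) (hvN : v ∉ N)
    {ω : Config E} (h1 : ω e₁ = true) (h2 : ω e₂ = false) :
    (if ω ∈ twoWorld ends s A X B Y ∧ CoreAvoid ends s N ω ∧ ¬ (Conn ends ω s v ∧ Conn ends (compl ω) s v) then (1 : ℕ) else 0) = (if ω ∈ twoWorld (endsLoop ends v e₁ e₂) s A X B Y ∧ CoreAvoid (endsLoop ends v e₁ e₂) s N ω then (if (Conn (endsLoop ends v e₁ e₂) ω s u₁ ∧ Conn (endsLoop ends v e₁ e₂) (compl ω) s u₂) then 0 else 1) else (0 : ℕ)) := by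
  have hw : ∀ w ∈ A ∪ X ∪ B ∪ Y, w ≠ v := fun w hw hwv => hv (hwv ▸ hw)
  have hwN : ∀ w ∈ N, w ≠ v := fun w hw hwv => hvN (hwv ▸ hw)
  obtain ⟨hc1, hv1⟩ := conn_iff_endsLoop ends s hd hsv h1 h2
  have h1' : compl ω e₂ = true := by simp [compl_apply, h2]
  have h2' : compl ω e₁ = false := by simp [compl_apply, h1]
  obtain ⟨hc2, hv2⟩ := conn_iff_endsLoop ends s hd.swap hsv h1' h2'
  rw [endsLoop_swap ends hd.ne] at hc2 hv2
  have htw : ω ∈ twoWorld ends s A X B Y ↔ ω ∈ twoWorld (endsLoop ends v e₁ e₂) s A X B Y :=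
    mem_twoWorld_iff_of_conn_iff ends s A X B Y (fun w hw' => hc1 w (hw w hw'))
      (fun w hw' => hc2 w (hw w hw'))
  have hca : CoreAvoid ends s N ω ↔ CoreAvoid (endsLoop ends v e₁ e₂) s N ω :=
    coreAvoid_iff_of_conn_iff ends s N (fun w hw' => hc1 w (hwN w hw')) (fun w hw' => hc2 w (hwN w hw'))
  by_cases h : ω ∈ twoWorld ends s A X B Y ∧ CoreAvoid ends s N ω
  · rw [if_pos (show ω ∈ twoWorld (endsLoop ends v e₁ e₂) s A X B Y ∧ CoreAvoid (endsLoop ends v e₁ e₂) s N ω from ⟨htw.1 h.1, hca.1 h.2⟩)]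
    by_cases hp : (Conn (endsLoop ends v e₁ e₂) ω s u₁ ∧ Conn (endsLoop ends v e₁ e₂) (compl ω) s u₂)
    · rw [if_pos hp, if_neg (show ¬ (ω ∈ twoWorld ends s A X B Y ∧ CoreAvoid ends s N ω ∧
          ¬ (Conn ends ω s v ∧ Conn ends (compl ω) s v)) from
          fun h' => h'.2.2 ⟨hv1.2 hp.1, hv2.2 hp.2⟩)]
    · rw [if_neg hp, if_pos (show ω ∈ twoWorld ends s A X B Y ∧ CoreAvoid ends s N ω ∧
          ¬ (Conn ends ω s v ∧ Conn ends (compl ω) s v) from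
          ⟨h.1, h.2, fun hc => hp ⟨hv1.1 hc.1, hv2.1 hc.2⟩⟩)]
  · rw [if_neg (show ¬ (ω ∈ twoWorld ends s A X B Y ∧ CoreAvoid ends s N ω ∧
        ¬ (Conn ends ω s v ∧ Conn ends (compl ω) s v)) from fun h' => h ⟨h'.1, h'.2.1⟩),
      if_neg (show ¬ (ω ∈ twoWorld (endsLoop ends v e₁ e₂) s A X B Y ∧ CoreAvoid (endsLoop ends v e₁ e₂) s N ω) from fun h' => h ⟨htw.2 h'.1, hca.2 h'.2⟩)]

/-- `e₁` closed, `e₂` open, with `N`. -/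
lemma term_FTN (hd : Deg2 ends v u₁ u₂ e₁ e₂) (hsv : s ≠ v) (hv : v ∉ A ∪ X ∪ B ∪ Y) (hvN : v ∉ N)
    {ω : Config E} (h1 : ω e₁ = false) (h2 : ω e₂ = true) :
    (if ω ∈ twoWorld ends s A X B Y ∧ CoreAvoid ends s N ω ∧ ¬ (Conn ends ω s v ∧ Conn ends (compl ω) s v) then (1 : ℕ) else 0) = (if ω ∈ twoWorld (endsLoop ends v e₁ e₂) s A X B Y ∧ CoreAvoid (endsLoop ends v e₁ e₂) s N ω then (if (Conn (endsLoop ends v e₁ e₂) ω s u₂ ∧ Conn (endsLoop ends v e₁ e₂) (compl ω) s u₁) then 0 else 1) else (0 : ℕ)) := by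
  have hw : ∀ w ∈ A ∪ X ∪ B ∪ Y, w ≠ v := fun w hw hwv => hv (hwv ▸ hw)
  have hwN : ∀ w ∈ N, w ≠ v := fun w hw hwv => hvN (hwv ▸ hw)
  obtain ⟨hc1, hv1⟩ := conn_iff_endsLoop ends s hd.swap hsv h2 h1
  rw [endsLoop_swap ends hd.ne] at hc1 hv1
  have h1' : compl ω e₁ = true := by simp [compl_apply, h1]
  have h2' : compl ω e₂ = false := by simp [compl_apply, h2]
  obtain ⟨hc2, hv2⟩ := conn_iff_endsLoop ends s hd hsv h1' h2'
  have htw : ω ∈ twoWorld ends s A X B Y ↔ ω ∈ twoWorld (endsLoop ends v e₁ e₂) s A X B Y :=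
    mem_twoWorld_iff_of_conn_iff ends s A X B Y (fun w hw' => hc1 w (hw w hw'))
      (fun w hw' => hc2 w (hw w hw'))
  have hca : CoreAvoid ends s N ω ↔ CoreAvoid (endsLoop ends v e₁ e₂) s N ω :=
    coreAvoid_iff_of_conn_iff ends s N (fun w hw' => hc1 w (hwN w hw')) (fun w hw' => hc2 w (hwN w hw'))
  by_cases h : ω ∈ twoWorld ends s A X B Y ∧ CoreAvoid ends s N ω
  · rw [if_pos (show ω ∈ twoWorld (endsLoop ends v e₁ e₂) s A X B Y ∧ CoreAvoid (endsLoop ends v e₁ e₂) s N ω from ⟨htw.1 h.1, hca.1 h.2⟩)]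
    by_cases hp : (Conn (endsLoop ends v e₁ e₂) ω s u₂ ∧ Conn (endsLoop ends v e₁ e₂) (compl ω) s u₁)
    · rw [if_pos hp, if_neg (show ¬ (ω ∈ twoWorld ends s A X B Y ∧ CoreAvoid ends s N ω ∧
          ¬ (Conn ends ω s v ∧ Conn ends (compl ω) s v)) from
          fun h' => h'.2.2 ⟨hv1.2 hp.1, hv2.2 hp.2⟩)]
    · rw [if_neg hp, if_pos (show ω ∈ twoWorld ends s A X B Y ∧ CoreAvoid ends s N ω ∧
          ¬ (Conn ends ω s v ∧ Conn ends (compl ω) s v) from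
          ⟨h.1, h.2, fun hc => hp ⟨hv1.1 hc.1, hv2.1 hc.2⟩⟩)]
  · rw [if_neg (show ¬ (ω ∈ twoWorld ends s A X B Y ∧ CoreAvoid ends s N ω ∧
        ¬ (Conn ends ω s v ∧ Conn ends (compl ω) s v)) from fun h' => h ⟨h'.1, h'.2.1⟩),
      if_neg (show ¬ (ω ∈ twoWorld (endsLoop ends v e₁ e₂) s A X B Y ∧ CoreAvoid (endsLoop ends v e₁ e₂) s N ω) from fun h' => h ⟨htw.2 h'.1, hca.2 h'.2⟩)]

/-- The pointwise split with `N`. -/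
lemma term_splitN (hd : Deg2 ends v u₁ u₂ e₁ e₂) (hsv : s ≠ v) (hv : v ∉ A ∪ X ∪ B ∪ Y) (hvN : v ∉ N)
    (ω : Config E) :
    (if ω ∈ twoWorld ends s A X B Y ∧ CoreAvoid ends s N ω ∧ ¬ (Conn ends ω s v ∧ Conn ends (compl ω) s v) then (1 : ℕ) else 0) = sel (ω e₁) (ω e₂) (if ω ∈ twoWorld (endsPlus ends v u₁ u₂ e₁ e₂) s A X B Y ∧ CoreAvoid (endsPlus ends v u₁ u₂ e₁ e₂) s N ω then (1 : ℕ) else 0) (if ω ∈ twoWorld (endsLoop ends v e₁ e₂) s A X B Y ∧ CoreAvoid (endsLoop ends v e₁ e₂) s N ω then (if (Conn (endsLoop ends v e₁ e₂) ω s u₁ ∧ Conn (endsLoop ends v e₁ e₂) (compl ω) s u₂) then 0 else 1) else (0 : ℕ)) (if ω ∈ twoWorld (endsLoop ends v e₁ e₂) s A X B Y ∧ CoreAvoid (endsLoop ends v e₁ e₂) s N ω then (if (Conn (endsLoop ends v e₁ e₂) ω s u₂ ∧ Conn (endsLoop ends v e₁ e₂) (compl ω) s u₁) then 0 else 1) else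 (0 : ℕ)) := by
  cases h1 : ω e₁ <;> cases h2 : ω e₂
  · show (if ω ∈ twoWorld ends s A X B Y ∧ CoreAvoid ends s N ω ∧ ¬ (Conn ends ω s v ∧ Conn ends (compl ω) s v) then (1 : ℕ) else 0) = (if ω ∈ twoWorld (endsPlus ends v u₁ u₂ e₁ e₂) s A X B Y ∧ CoreAvoid (endsPlus ends v u₁ u₂ e₁ e₂) s N ω then (1 : ℕ) else 0)
    exact term_sameN ends s A X B Y N hd hsv hv hvN (h1.trans h2.symm)
  · show (if ω ∈ twoWorld ends s A X B Y ∧ CoreAvoid ends s N ω ∧ ¬ (Conn ends ω s v ∧ Conn ends (compl ω) s v) then (1 : ℕ) else 0) = (if ω ∈ twoWorld (endsLoop ends v e₁ e₂) s A X B Y ∧ CoreAvoid (endsLoop ends v e₁ e₂) s N ω then (if (Conn (endsLoop ends v e₁ e₂) ω s u₂ ∧ Conn (endsLoop ends v e₁ e₂) (compl ω) s u₁) then 0 else 1) else (0 : ℕ))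
    exact term_FTN ends s A X B Y N hd hsv hv hvN h1 h2
  · show (if ω ∈ twoWorld ends s A X B Y ∧ CoreAvoid ends s N ω ∧ ¬ (Conn ends ω s v ∧ Conn ends (compl ω) s v) then (1 : ℕ) else 0) = (if ω ∈ twoWorld (endsLoop ends v e₁ e₂) s A X B Y ∧ CoreAvoid (endsLoop ends v e₁ e₂) s N ω then (if (Conn (endsLoop ends v e₁ e₂) ω s u₁ ∧ Conn (endsLoop ends v e₁ e₂) (compl ω) s u₂) then 0 else 1) else (0 : ℕ))
    exact term_TFN ends s A X B Y N hd hsv hv hvN h1 h2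
  · show (if ω ∈ twoWorld ends s A X B Y ∧ CoreAvoid ends s N ω ∧ ¬ (Conn ends ω s v ∧ Conn ends (compl ω) s v) then (1 : ℕ) else 0) = (if ω ∈ twoWorld (endsPlus ends v u₁ u₂ e₁ e₂) s A X B Y ∧ CoreAvoid (endsPlus ends v u₁ u₂ e₁ e₂) s N ω then (1 : ℕ) else 0)
    exact term_sameN ends s A X B Y N hd hsv hv hvN (h1.trans h2.symm)

omit [Fintype E] [Fintype V] [DecidableEq V] in
/-- The `G⁺` term with `N` is blind to the colour of `e₂`. -/
lemma gplus_flipN (ω : Config E) :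
    (if flipE e₂ ω ∈ twoWorld (endsPlus ends v u₁ u₂ e₁ e₂) s A X B Y ∧
        CoreAvoid (endsPlus ends v u₁ u₂ e₁ e₂) s N (flipE e₂ ω) then (1 : ℕ) else 0) = (if ω ∈ twoWorld (endsPlus ends v u₁ u₂ e₁ e₂) s A X B Y ∧ CoreAvoid (endsPlus ends v u₁ u₂ e₁ e₂) s N ω then (1 : ℕ) else 0) := by
  have hloop : (endsPlus ends v u₁ u₂ e₁ e₂ e₂).IsDiag := by
    rw [endsPlus_e₂]; exact Sym2.mk_isDiag_iff.2 rfl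
  unfold flipE
  rw [mem_twoWorld_update_of_loop s hloop, coreAvoid_update_of_loop s N hloop]

/-- A `G°` term with `N` is blind to the colour of a loop `e`. -/
lemma gloop_flipN (hne : e₁ ≠ e₂) {e : E} (he : e = e₁ ∨ e = e₂) (a b : V) (ω : Config E) :
    (if flipE e ω ∈ twoWorld (endsLoop ends v e₁ e₂) s A X B Y ∧
        CoreAvoid (endsLoop ends v e₁ e₂) s N (flipE e ω) then
        (if Conn (endsLoop ends v e₁ e₂) (flipE e ω) s a ∧
          Conn (endsLoop ends v e₁ e₂) (compl (flipE e ω)) s b then 0 else 1) else (0 : ℕ)) =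
      (if ω ∈ twoWorld (endsLoop ends v e₁ e₂) s A X B Y ∧ CoreAvoid (endsLoop ends v e₁ e₂) s N ω then
        (if Conn (endsLoop ends v e₁ e₂) ω s a ∧ Conn (endsLoop ends v e₁ e₂) (compl ω) s b
          then 0 else 1) else 0) := by
  have hloop : (endsLoop ends v e₁ e₂ e).IsDiag := by
    rcases he with rfl | rfl
    · rw [endsLoop_e₁ ends hne]; exact Sym2.mk_isDiag_iff.2 rfl
    · rw [endsLoop_e₂]; exact Sym2.mk_isDiag_iff.2 rfl
  unfold flipE
  simp only [mem_twoWorld_update_of_loop s hloop, coreAvoid_update_of_loop s N hloop, compl_update_flip,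
    conn_update_of_loop hloop]

/-- **The degree-2 expansion with `N`**:
`4 · coreCount A X B Y (insert v N) = 2 · coreCount⁺ A X B Y N + coreGensymCount° A X B Y N u₁ u₂`. -/
theorem four_mul_coreCount_insert (hd : Deg2 ends v u₁ u₂ e₁ e₂) (hsv : s ≠ v) (hv : v ∉ A ∪ X ∪ B ∪ Y)
    (hvN : v ∉ N) :
    4 * coreCount ends s A X B Y (insert v N) =
      2 * coreCount (endsPlus ends v u₁ u₂ e₁ e₂) s A X B Y N +
        coreGensymCount (endsLoop ends v e₁ e₂) s A X B Y N u₁ u₂ := by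
  have hsplit : ∑ ω : Config E, (if ω ∈ twoWorld ends s A X B Y ∧ CoreAvoid ends s N ω ∧ ¬ (Conn ends ω s v ∧ Conn ends (compl ω) s v) then (1 : ℕ) else 0) =
      ∑ ω : Config E, (if ω e₁ = ω e₂ then (if ω ∈ twoWorld (endsPlus ends v u₁ u₂ e₁ e₂) s A X B Y ∧ CoreAvoid (endsPlus ends v u₁ u₂ e₁ e₂) s N ω then (1 : ℕ) else 0) else 0) +
        (∑ ω : Config E, (if ω e₁ = true ∧ ω e₂ = false then (if ω ∈ twoWorld (endsLoop ends v e₁ e₂) s A X B Y ∧ CoreAvoid (endsLoop ends v e₁ e₂) s N ω then (if (Conn (endsLoop ends v e₁ e₂) ω s u₁ ∧ Conn (endsLoop ends v e₁ e₂) (compl ω) s u₂) then 0 else 1) else (0 : ℕ)) else 0) +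
          ∑ ω : Config E, (if ω e₁ = false ∧ ω e₂ = true then (if ω ∈ twoWorld (endsLoop ends v e₁ e₂) s A X B Y ∧ CoreAvoid (endsLoop ends v e₁ e₂) s N ω then (if (Conn (endsLoop ends v e₁ e₂) ω s u₂ ∧ Conn (endsLoop ends v e₁ e₂) (compl ω) s u₁) then 0 else 1) else (0 : ℕ)) else 0)) := by
    rw [← sum_sel]
    exact Finset.sum_congr rfl fun ω _ => term_splitN ends s A X B Y N hd hsv hv hvN ω
  have hG := two_mul_sum_same e₁ e₂ hd.ne (fun ω => (if ω ∈ twoWorld (endsPlus ends v u₁ u₂ e₁ e₂) s A X B Y ∧ CoreAvoid (endsPlus ends v u₁ u₂ e₁ e₂) s N ω then (1 : ℕ) else 0)) (fun ω => gplus_flipN ends s A X B Y N ω)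
  have hH₁ := four_mul_sum_pattern e₁ e₂ hd.ne (fun ω => (if ω ∈ twoWorld (endsLoop ends v e₁ e₂) s A X B Y ∧ CoreAvoid (endsLoop ends v e₁ e₂) s N ω then (if (Conn (endsLoop ends v e₁ e₂) ω s u₁ ∧ Conn (endsLoop ends v e₁ e₂) (compl ω) s u₂) then 0 else 1) else (0 : ℕ)))
    (fun ω => gloop_flipN ends s A X B Y N hd.ne (Or.inl rfl) u₁ u₂ ω)
    (fun ω => gloop_flipN ends s A X B Y N hd.ne (Or.inr rfl) u₁ u₂ ω) true false
  have hH₂ := four_mul_sum_pattern e₁ e₂ hd.ne (fun ω => (if ω ∈ twoWorld (endsLoop ends v e₁ e₂) s A X B Y ∧ CoreAvoid (endsLoop ends v e₁ e₂) s N ω then (if (Conn (endsLoop ends v e₁ e₂) ω s u₂ ∧ Conn (endsLoop ends v e₁ e₂) (compl ω) s u₁) then 0 else 1) else (0 : ℕ)))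
    (fun ω => gloop_flipN ends s A X B Y N hd.ne (Or.inl rfl) u₂ u₁ ω)
    (fun ω => gloop_flipN ends s A X B Y N hd.ne (Or.inr rfl) u₂ u₁ ω) false true
  have hGS : coreGensymCount (endsLoop ends v e₁ e₂) s A X B Y N u₁ u₂ =
      ∑ ω : Config E, (if ω ∈ twoWorld (endsLoop ends v e₁ e₂) s A X B Y ∧ CoreAvoid (endsLoop ends v e₁ e₂) s N ω then (if (Conn (endsLoop ends v e₁ e₂) ω s u₁ ∧ Conn (endsLoop ends v e₁ e₂) (compl ω) s u₂) then 0 else 1) else (0 : ℕ)) + ∑ ω : Config E, (if ω ∈ twoWorld (endsLoop ends v e₁ e₂) s A X B Y ∧ CoreAvoid (endsLoop ends v e₁ e₂) s N ω then (if (Conn (endsLoop ends v e₁ e₂) ω s u₂ ∧ Conn (endsLoop ends v e₁ e₂) (compl ω) s u₁) then 0 else 1) else (0 : ℕ)) := by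
    unfold coreGensymCount pairW
    rw [← Finset.sum_add_distrib]
    refine Finset.sum_congr rfl fun ω _ => ?_
    by_cases h : ω ∈ twoWorld (endsLoop ends v e₁ e₂) s A X B Y ∧ CoreAvoid (endsLoop ends v e₁ e₂) s N ω
    · rw [if_pos h, if_pos h, if_pos h]
    · rw [if_neg h, if_neg h, if_neg h]
  rw [coreCount_insert_eq_sum, hsplit, coreCount_eq_sum_coreAvoid, hGS]
  beta_reduce at hG hH₁ hH₂
  generalize (∑ ω : Config E, (if ω e₁ = ω e₂ then (if ω ∈ twoWorld (endsPlus ends v u₁ u₂ e₁ e₂) s A X B Y ∧ CoreAvoid (endsPlus ends v u₁ u₂ e₁ e₂) s N ω then (1 : ℕ) else 0) else 0)) = S1 at hG ⊢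
  generalize (∑ ω : Config E, (if ω ∈ twoWorld (endsPlus ends v u₁ u₂ e₁ e₂) s A X B Y ∧ CoreAvoid (endsPlus ends v u₁ u₂ e₁ e₂) s N ω then (1 : ℕ) else 0)) = SG at hG ⊢
  generalize (∑ ω : Config E, (if ω e₁ = true ∧ ω e₂ = false then (if ω ∈ twoWorld (endsLoop ends v e₁ e₂) s A X B Y ∧ CoreAvoid (endsLoop ends v e₁ e₂) s N ω then (if (Conn (endsLoop ends v e₁ e₂) ω s u₁ ∧ Conn (endsLoop ends v e₁ e₂) (compl ω) s u₂) then 0 else 1) else (0 : ℕ)) else 0)) = S2 at hH₁ ⊢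
  generalize (∑ ω : Config E, (if ω ∈ twoWorld (endsLoop ends v e₁ e₂) s A X B Y ∧ CoreAvoid (endsLoop ends v e₁ e₂) s N ω then (if (Conn (endsLoop ends v e₁ e₂) ω s u₁ ∧ Conn (endsLoop ends v e₁ e₂) (compl ω) s u₂) then 0 else 1) else (0 : ℕ))) = SH1 at hH₁ ⊢
  generalize (∑ ω : Config E, (if ω e₁ = false ∧ ω e₂ = true then (if ω ∈ twoWorld (endsLoop ends v e₁ e₂) s A X B Y ∧ CoreAvoid (endsLoop ends v e₁ e₂) s N ω then (if (Conn (endsLoop ends v e₁ e₂) ω s u₂ ∧ Conn (endsLoop ends v e₁ e₂) (compl ω) s u₁) then 0 else 1) else (0 : ℕ)) else 0)) = S3 at hH₂ ⊢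
  generalize (∑ ω : Config E, (if ω ∈ twoWorld (endsLoop ends v e₁ e₂) s A X B Y ∧ CoreAvoid (endsLoop ends v e₁ e₂) s N ω then (if (Conn (endsLoop ends v e₁ e₂) ω s u₂ ∧ Conn (endsLoop ends v e₁ e₂) (compl ω) s u₁) then 0 else 1) else (0 : ℕ))) = SH2 at hH₂ ⊢
  omega

/-- **The degree-2 rule of the calculus**: (CORE↓) at `N` on `G⁺` and the `N`-weighted GENSYM`(u₁, u₂)` on
`G°` give (CORE↓) at `insert v N` on `G`, for an unmarked `v ≠ s` of degree 2 not in `N`. -/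
theorem coreDown_insert_of_genSymN (hd : Deg2 ends v u₁ u₂ e₁ e₂) (hsv : s ≠ v) (hv : v ∉ A ∪ X ∪ B ∪ Y)
    (hvN : v ∉ N) (hP : CoreDown (endsPlus ends v u₁ u₂ e₁ e₂) s A X B Y N)
    (hGS : GenSymN (endsLoop ends v e₁ e₂) s A X B Y N u₁ u₂) :
    CoreDown ends s A X B Y (insert v N) := by
  unfold CoreDown at hP ⊢
  unfold GenSymN at hGS
  have hv' : v ∉ (A ∪ B) ∪ ∅ ∪ ∅ ∪ (X ∪ Y) := by
    rw [Finset.union_empty, Finset.union_empty]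
    intro h
    rcases Finset.mem_union.1 h with h | h <;> rcases Finset.mem_union.1 h with h | h
    · exact hv (Finset.mem_union_left _ (Finset.mem_union_left _ (Finset.mem_union_left _ h)))
    · exact hv (Finset.mem_union_left _ (Finset.mem_union_right _ h))
    · exact hv (Finset.mem_union_left _ (Finset.mem_union_left _ (Finset.mem_union_right _ h)))
    · exact hv (Finset.mem_union_right _ h)
  have hL := four_mul_coreCount_insert ends s A X B Y N hd hsv hv hvN
  have hR := four_mul_coreCount_insert ends s (A ∪ B) ∅ ∅ (X ∪ Y) N hd hsv hv' hvN
  have : 4 * coreCount ends s A X B Y (insert v N) ≤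
      4 * coreCount ends s (A ∪ B) ∅ ∅ (X ∪ Y) (insert v N) := by
    rw [hL, hR]
    exact Nat.add_le_add (Nat.mul_le_mul_left 2 hP) hGS
  exact Nat.le_of_mul_le_mul_left this (by norm_num)

end Expansion

end ReimerVdBK
end Summit.Ventures.PercRepro2
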